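import Literature.AlgebraicGeometry.Motives.HodgeStructureLefschetzGroupPoints
import Literature.AlgebraicGeometry.Motives.HodgeStructureEndAlgPositiveInvolution
import HarnessLib

/-!
# Milne's centre `C₀ = Z(E_φ)` and centraliser `C = End_{E_φ}(V)` for a `ℚ`-Hodge structure WITH MANY ENDOMORPHISMS (= of CM
# type): `C(H) = C₀(H)` ("the canonical map `C₀(A) ⊗ Q → C(A)` is an isomorphism"), `C(H)` lies in every maximal commutative
# semisimple subalgebra of `E_φ`, and the Lefschetz groups `S(H)(K) ⊆ G(H)(K)` are COMMUTATIVE — conversely `S(H)(ℚ)` (or `C(H)`,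
# or any `S(H)(K)`, `G(H)(K)`) commutative forces CM (Milne 1999b Remark 1.10; Milne 1999a p. 645; GGK §V.B "`Z = T`")

[topic AlgebraicGeometry/Motives]

Layer `Literature/AlgebraicGeometry/Motives`, lane `lit-hodgefound` (Track 2 foundations library; seat `lit-hodgefound-p34`,
generation 18, self-proposed row g18-#6 of `run/shared/lean/pub/lit-hodgefound/SKELETON.md`). THEOREMS ONLY (no definition,
no named fact; net debt `0`). Sixth file of the seat's programme «Milne 1999 §1 on the abstract polarized `ℚ`-Hodge structure,
on `K`-points»: the CM case of Milne's objects of g18-#1 `Motives/HodgeStructureLefschetzGroupPoints` — the centraliser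
`C(H) = Subalgebra.centralizer ℚ E_φ` of the endomorphism algebra `E_φ = H.endAlg`, its involution `† = Polarization.adjoint`,
the groups `S(H)(K) = Polarization.lefschetzGroupBaseChange K Q` ("`{γ ∈ C(A) ⊗ R | γ†γ = 1}`"),
`G(H)(K) = Polarization.lefschetzSimilitudeGroupBaseChange K Q` and `S(H)(ℚ) = Polarization.lefschetzGroup Q` — joined to the
tree's CENTRE `Subalgebra.center ℚ H.endAlg` (`Motives/HodgeStructureEndAlgPositiveInvolution`: `†`-stable, totally real or CM)
and to the tree's CM notion «`Lie Hg(H) ⊆ E_φ`» (`H.hodgeLie ≤ Subalgebra.toSubmodule H.endAlg`; p02's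
`Motives/HodgeGroupCommutativeIffCM[Points]`: iff `Hg(H)(K)` commutative, iff `Hg(H)(ℚ) ⊆ E_φ`, iff — for polarizable `H` —
`E_φ` contains a commutative semisimple `ℚ`-subalgebra of dimension `dim V`, Milne's "MANY ENDOMORPHISMS"). Milne states
Remark 1.10 for abelian varieties with many endomorphisms and any Weil cohomology with coefficient field `Q`; for the Betti
cohomology of a complex abelian variety (`Q = ℚ`, `E_φ = End⁰(A)`, "many endomorphisms" = CM type) it is the statement
proved here on the abstract carrier `HodgeStructure V n` (any weight), with `K`-points for every field `K ⊇ ℚ`. The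
`ℂ`-points twin for CM abelian varieties on `H¹(A(ℂ); ℂ)` is `Milne1999/LefschetzCentraliserCM` — OTHER carrier, BY NAME,
nothing imported or restated.

## The sources, verbatim

* J. S. Milne, *Lefschetz motives and the Tate conjecture*, Compositio Math. **117** (1999) 47–81 [Milne1999] (held
  `paper:doi-10-1023-a-1000776613765`), Remark 1.10, p0008 L1–L9 (p. 52): "Let `H₁(A)` be the linear dual of `H¹(A)`, and
  let `C(A)` be the centralizer of `End⁰(A)` in `End(H₁(A))`. A polarization `λ: A → A^∨` of `A` determines an involution
  `α ↦ α† = H₁(λ)⁻¹ ∘ H₁(α^∨) ∘ H₁(λ)` of `End(H₁(A))` whose restriction to `C(A)` is independent of the choice of `λ`. The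
  Lefschetz group `L(A)` of `A` is the algebraic subgroup of `GL(H₁(A)) × 𝔾_m` such that
  `L(A)(R) = {(γ, c) ∈ (C(A) ⊗ R)^× × R^× | γ†γ = c}`"; p0009 L17–L35 (p. 53): "For an Abelian variety `A`,
  `[End⁰(A) : Q]_red ≤ 2 dim A`, and when equality holds we say that `A` has many endomorphisms. Let `A` be a simple Abelian
  variety with many endomorphisms, and let `C₀(A)` be the centre of `End⁰(A)`. **A Rosati involution on `End⁰(A)` defines an
  involution on `C₀(A)`, which is independent of the choice of the Rosati involution.** For any Weil cohomology theory `H`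
  with coefficient field `Q`, **the canonical map `C₀(A) ⊗_ℚ Q → C(A)` is an isomorphism** – this follows easily from the
  definition of `A`'s having many endomorphisms and the fact that `H₁(A)` is a free `C₀(A) ⊗_ℚ Q`-module (Milne, 1999a,
  2.1). Therefore, `L(A) ≅ L₀(A)_{/Q}` where `L₀(A)` is the algebraic group over `ℚ` such that
  `L₀(A)(R) = {(γ, c) ∈ C₀(A)^× × R^× | γ†γ = c}` for all `ℚ`-algebras `R`. **This shows that `π(A)` is commutative**
  (because its realizations are)".
* J. S. Milne, *Lefschetz classes on abelian varieties*, Duke Math. J. **96** (1999) 639–675 [Milne1999LefschetzClasses]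
  (held `paper:doi-10-1215-s0012-7094-99-09620-5`), p0007 L4–L9 (p. 645, the finite-field archetype of the same shape):
  "let `C₀(A)` be the centre of the `ℚ`-algebra `End⁰(A)` — it is a product of fields, each of which is either a CM-field
  or `ℚ`. Every Rosati involution `†` preserves each factor of `C₀(A)` and acts on it as complex conjugation. Define `S₀(A)`
  to be the algebraic group over `ℚ` such that, for all commutative `ℚ`-algebras `R`, `S₀(A)(R) = {γ ∈ C₀(A) ⊗_ℚ R | γ†γ = 1}`.
  **Proposition 1.7.** The action of `End⁰(A)` on `V_ℓ(A)` induces an isomorphism `C₀(A) ⊗_ℚ ℚ_ℓ → C_ℓ(A)` of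
  `ℚ_ℓ`-algebras with involution, and hence an isomorphism of algebraic groups `S₀(A)_{/ℚ_ℓ} → S_ℓ(A)`."
* M. Green, P. Griffiths, M. Kerr, *Mumford–Tate groups and domains* (2012) [GreenGriffithsKerr2012], §V.B (ii)
  "`M_φ(ℚ) ⊆ E_φ`" and (V.2) (proof) "`E^*` is just the `ℚ`-points of the centralizer `Z := Z_{G̃}(M)` […] `Z = T`" (the
  tree's reading `centralizer_endAlg_le_endAlg_iff_forall_hodgeGroup_mem_endAlg`: `C(H) ⊆ E_φ` iff `Hg(H)(ℚ) ⊆ E_φ`).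
* H. Lange, *Abelian Varieties over the Complex Numbers* (2023) [Lange2023AbelianVarietiesComplex], §7.2.3 proof of
  Prop. 7.2.6 ((ii) ⇒ (i)): "By the maximality of `T`, the centralizer of `T` is `T` itself" (the tree's
  `Subalgebra.centralizer_eq_self_of_comm_isReduced_finrank_eq`).

## What is PROVED (every pure `ℚ`-HS `H : HodgeStructure V n` on a finite-dimensional `V`; `E = E_φ`, `C = C(H)`)

* §1 **`C₀(H)` in two spellings and its involution**: `a ∈ Z(E_φ)` (the tree's `Subalgebra.center ℚ H.endAlg`) iff
  `↑a ∈ C(H)` (`mem_center_endAlg_iff_coe_mem_centralizer_endAlg`); `C₀(H) := (Z(E_φ)).map val = E ⊓ C`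
  (`map_val_center_endAlg_eq_endAlg_inf_centralizer_endAlg`); for polarizable `H`, `E ⊓ C = C ⊓ C(C)` — the centre of `E_φ`
  is the centre of `C(H)` (Remark 1.2 `C(C) = E`; `endAlg_inf_centralizer_endAlg_eq_centralizer_inf`); **"a Rosati involution
  defines an involution on `C₀`, independent of the choice"**: `†` preserves `E ⊓ C` and two polarizations have the same
  `†` there (`Polarization.adjoint_mem_endAlg_inf_centralizer_endAlg`, `….adjoint_eq_adjoint_of_mem_endAlg_inf_centralizer_endAlg`,
  and in the tree's spelling `Polarization.adjointEndAlg_eq_adjointEndAlg_of_mem_center`).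
* §2 **MANY ENDOMORPHISMS ⟹ `C = C₀`**: if `E_φ ⊇ S`, `S` a commutative reduced `ℚ`-subalgebra with `dim S = dim V`, then
  **`C(H) ⊆ S`** (`C = C(E) ⊆ C(S) = S`; `centralizer_endAlg_le_of_comm_isReduced_le_endAlg`), hence `C(H) ⊆ E_φ`, `C(H)`
  is commutative (`centralizer_endAlg_comm_of_comm_isReduced_le_endAlg`) and `C₀(H) = C(H)`
  (`map_val_center_endAlg_eq_centralizer_endAlg_of_comm_isReduced_le_endAlg`). In the tree's CM spelling:
  **`C₀(H) = C(H) ⟺ Lie Hg ⊆ E_φ`** (`map_val_center_endAlg_eq_centralizer_endAlg_iff_hodgeLie_le`, no polarization) and,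
  for POLARIZABLE `H`, **`C(H)` is commutative ⟺ `Lie Hg ⊆ E_φ`** (`centralizer_endAlg_comm_iff_hodgeLie_le`; "⟹": a
  commutative `C` lies in `C(C) = E_φ`).
* §3 **"`L(A) ≅ L₀(A)` … this shows that `π(A)` is commutative"**: for every field `K ⊇ ℚ`, **`S(H)(K)` is commutative iff
  `Lie Hg ⊆ E_φ`** (`Polarization.lefschetzGroupBaseChange_comm_iff_hodgeLie_le`; "⟸": `S(H)(K) ⊆ C ⊗ K` with `C ⊆ E_φ`
  commuting with `S(H)(K)`; "⟹": `Hg(H)(K) ⊆ S(H)(K)` and p02's `Hg(H)(K)` commutative iff CM), the same for the similitude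
  group **`G(H)(K)`** (`….lefschetzSimilitudeGroupBaseChange_comm_iff_hodgeLie_le`, through `MT(H)(K) ⊆ G(H)(K)`) and for
  `S(H)(ℚ)` (`….lefschetzGroup_comm_iff_hodgeLie_le`); and Milne's shape of the CM Lefschetz group: `S(H)(ℚ) = S₀(H)(ℚ) =
  {γ ∈ C₀(H) | γ†γ = 1}` (`….mem_lefschetzGroup_iff_exists_center_of_hodgeLie_le`) and `S(H)(K) ⊆ C₀(H) ⊗ K`
  (`….coe_mem_span_baseChange_center_of_mem_lefschetzGroupBaseChange`).

NOT here: "`H₁(A)` is a free `C₀(A) ⊗ Q`-module" (Milne 1999a 2.1), the factor `𝔾_m` of `L(A)` beyond `G(H)(K)`, the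
structure of `C₀` as a product of CM fields (the tree's `Polarization.isTotallyReal_or_isCMField_of_ringEquiv_center` treats
the field case), Milne 1999a Prop. 1.7 itself (finite fields, `ℓ`-adic: Tate's theorem), abelian varieties.

## References

* [Milne1999] J. S. Milne, *Lefschetz motives and the Tate conjecture*, Compositio Math. 117 (1999) 47–81, Remark 1.10
  (pp. 52–53).
* [Milne1999LefschetzClasses] J. S. Milne, *Lefschetz classes on abelian varieties*, Duke Math. J. 96 (1999) 639–675, §1
  p. 645 (`C₀(A)`, `S₀(A)`, Proposition 1.7), Remark 1.2 (p. 643), p. 644 (the group `S(A)`).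
* [GreenGriffithsKerr2012] M. Green, P. Griffiths, M. Kerr, *Mumford–Tate Groups and Domains*, Ann. of Math. Studies 183
  (2012), §V.B (i)–(ii), (V.2).
* [Lange2023AbelianVarietiesComplex] H. Lange, *Abelian Varieties over the Complex Numbers*, Springer (2023), §7.2.3
  Prop. 7.2.6.
* [MumfordAV1970] D. Mumford, *Abelian Varieties* (1970), §21 (the centre of `(End⁰(A), †)`).
-/

noncomputable section

open TensorProduct

namespace Literature.AlgebraicGeometry.Motives

namespace HodgeStructure

universe u uK

variable {V : Type u} [AddCommGroup V] [Module ℚ V] {n : ℤ} (H : HodgeStructure V n)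

/-! ## §1 The centre `C₀(H) = Z(E_φ)` in two spellings, and its involution -/

section Center

/-- **`Z(E_φ)` versus `C(H)`**: an element of `E_φ` is central in `E_φ` (the tree's `Subalgebra.center ℚ H.endAlg`) iff, as an
endomorphism of `V`, it lies in Milne's centraliser `C(H) = End_{E_φ}(V)`. [cite: Milne1999, Remark 1.10 (p. 53, "C₀(A) … the centre of End⁰(A)")]
[cite: Milne1999LefschetzClasses, §1 p. 645 L4–L5] -/
theorem mem_center_endAlg_iff_coe_mem_centralizer_endAlg (a : H.endAlg) :
    a ∈ Subalgebra.center ℚ H.endAlg ↔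
      (a : Module.End ℚ V) ∈ Subalgebra.centralizer ℚ (H.endAlg : Set (Module.End ℚ V)) := by
  rw [Subalgebra.mem_center_iff, Subalgebra.mem_centralizer_iff]
  constructor
  · intro h b hb
    exact congrArg Subtype.val (h ⟨b, hb⟩)
  · intro h b
    exact Subtype.ext (h b b.2)

/-- **`C₀(H) = E_φ ∩ C(H)`**: the centre of `E_φ`, pushed into `End_ℚ(V)`, is the intersection of `E_φ` with its centraliser.
[cite: Milne1999, Remark 1.10 (p. 53)] [cite: Milne1999LefschetzClasses, §1 p. 645 L4–L5] -/
theorem map_val_center_endAlg_eq_endAlg_inf_centralizer_endAlg :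
    (Subalgebra.center ℚ H.endAlg).map H.endAlg.val =
      H.endAlg ⊓ Subalgebra.centralizer ℚ (H.endAlg : Set (Module.End ℚ V)) := by
  ext a
  rw [Subalgebra.mem_map, Algebra.mem_inf]
  constructor
  · rintro ⟨z, hz, rfl⟩
    exact ⟨z.2, (mem_center_endAlg_iff_coe_mem_centralizer_endAlg H z).1 hz⟩
  · rintro ⟨haE, haC⟩
    exact ⟨⟨a, haE⟩, (mem_center_endAlg_iff_coe_mem_centralizer_endAlg H ⟨a, haE⟩).2 haC, rfl⟩

/-- `C₀(H) = C(H)` (the canonical map `C₀ → C` is onto) iff `C(H) ⊆ E_φ`. [cite: Milne1999, Remark 1.10 (p. 53)] -/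
theorem map_val_center_endAlg_eq_centralizer_endAlg_iff :
    (Subalgebra.center ℚ H.endAlg).map H.endAlg.val = Subalgebra.centralizer ℚ (H.endAlg : Set (Module.End ℚ V)) ↔
      Subalgebra.centralizer ℚ (H.endAlg : Set (Module.End ℚ V)) ≤ H.endAlg := by
  rw [map_val_center_endAlg_eq_endAlg_inf_centralizer_endAlg, inf_eq_right]

variable [Module.Finite ℚ V]

/-- **The centre of `E_φ` is the centre of `C(H)`** for polarizable `H`: `E_φ ∩ C(H) = C(H) ∩ C(C(H))` (Remark 1.2: the
bicommutant `C(C(H))` is `E_φ`). [cite: Milne1999LefschetzClasses, §1 Remark 1.2 (p. 643)] [cite: Milne1999, Remark 1.10 (p. 53)] -/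
theorem endAlg_inf_centralizer_endAlg_eq_centralizer_inf [HodgeTensorFacts.{u, u}] (hH : H.IsPolarizable) :
    H.endAlg ⊓ Subalgebra.centralizer ℚ (H.endAlg : Set (Module.End ℚ V)) =
      Subalgebra.centralizer ℚ (H.endAlg : Set (Module.End ℚ V)) ⊓
        Subalgebra.centralizer ℚ
          ((Subalgebra.centralizer ℚ (H.endAlg : Set (Module.End ℚ V)) : Set (Module.End ℚ V))) := by
  rw [centralizer_centralizer_endAlg_eq H hH, inf_comm]

variable {H}

/-- **"A Rosati involution on `End⁰(A)` defines an involution on `C₀(A)`"**: `†` preserves `E_φ ∩ C(H)` (it preserves `E_φ`,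
Huybrechts 3.3.12, and `C(H)`, g18-#1). [cite: Milne1999, Remark 1.10 (p. 53)] [cite: Milne1999LefschetzClasses, §1 p. 645 L5–L6] -/
theorem Polarization.adjoint_mem_endAlg_inf_centralizer_endAlg (Q : Polarization H) {z : Module.End ℚ V}
    (hz : z ∈ H.endAlg ⊓ Subalgebra.centralizer ℚ (H.endAlg : Set (Module.End ℚ V))) :
    Q.adjoint z ∈ H.endAlg ⊓ Subalgebra.centralizer ℚ (H.endAlg : Set (Module.End ℚ V)) :=
  Algebra.mem_inf.2 ⟨Q.adjoint_mem_endAlg (Algebra.mem_inf.1 hz).1, Q.adjoint_mem_centralizer_endAlg (Algebra.mem_inf.1 hz).2⟩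

/-- **"… which is independent of the choice of the Rosati involution"**: two polarizations induce the same involution on
`E_φ ∩ C(H)` (g18-#1: already on all of `C(H)`). [cite: Milne1999, Remark 1.10 (p. 53)] [cite: Milne1999LefschetzClasses, §1 p. 643 L1–L2] -/
theorem Polarization.adjoint_eq_adjoint_of_mem_endAlg_inf_centralizer_endAlg [HodgeTensorFacts.{u, u}] (Q Q' : Polarization H)
    {z : Module.End ℚ V} (hz : z ∈ H.endAlg ⊓ Subalgebra.centralizer ℚ (H.endAlg : Set (Module.End ℚ V))) :
    Q.adjoint z = Q'.adjoint z :=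
  Q.adjoint_eq_adjoint_of_mem_centralizer_endAlg Q' (Algebra.mem_inf.1 hz).2

/-- The same in the tree's spelling `† : E_φ → E_φ` (`Polarization.adjointEndAlg`, which preserves `Z(E_φ)` by the tree's
`adjointEndAlg_mem_center`): on the centre `Z(E_φ)` the involutions of any two polarizations agree.
[cite: Milne1999, Remark 1.10 (p. 53)] [cite: MumfordAV1970, §21] -/
theorem Polarization.adjointEndAlg_eq_adjointEndAlg_of_mem_center [HodgeTensorFacts.{u, u}] (Q Q' : Polarization H)
    {z : H.endAlg} (hz : z ∈ Subalgebra.center ℚ H.endAlg) : Q.adjointEndAlg z = Q'.adjointEndAlg z :=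
  Subtype.ext (Q.adjoint_eq_adjoint_of_mem_centralizer_endAlg Q' ((mem_center_endAlg_iff_coe_mem_centralizer_endAlg H z).1 hz))

end Center

/-! ## §2 Many endomorphisms: `C(H) = C₀(H)`, `C(H)` inside every maximal commutative semisimple subalgebra of `E_φ` -/

section ManyEndomorphisms

variable [Module.Finite ℚ V]

/-- **"the canonical map `C₀(A) ⊗ Q → C(A)` is an isomorphism – this follows easily from the definition of `A`'s having many
endomorphisms"**, the mechanism: if `E_φ` contains a commutative reduced `ℚ`-subalgebra `S` with `dim_ℚ S = dim_ℚ V`, then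
**`C(H) ⊆ S`** — `C(H) = C(E_φ) ⊆ C(S)`, and `C(S) = S` by the maximality of `S` (the tree's
`Subalgebra.centralizer_eq_self_of_comm_isReduced_finrank_eq`). [cite: Milne1999, Remark 1.10 (p. 53)]
[cite: Lange2023AbelianVarietiesComplex, §7.2.3 Prop. 7.2.6 (proof of (ii) ⇒ (i))] -/
theorem centralizer_endAlg_le_of_comm_isReduced_le_endAlg (S : Subalgebra ℚ (Module.End ℚ V)) [IsReduced S]
    (hcomm : ∀ a ∈ S, ∀ b ∈ S, a * b = b * a) (hle : S ≤ H.endAlg) (hdim : Module.finrank ℚ S = Module.finrank ℚ V) :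
    Subalgebra.centralizer ℚ (H.endAlg : Set (Module.End ℚ V)) ≤ S := by
  intro c hc
  rw [← Subalgebra.centralizer_eq_self_of_comm_isReduced_finrank_eq S hcomm hdim, Subalgebra.mem_centralizer_iff]
  intro s hs
  exact (Subalgebra.mem_centralizer_iff ℚ).1 hc s (hle hs)

/-- **Many endomorphisms ⟹ `C(H) ⊆ E_φ`** (i.e. `C = Z(E_φ) = C₀`). [cite: Milne1999, Remark 1.10 (p. 53)]
[cite: GreenGriffithsKerr2012, Ch. V (V.2) (proof: "Z = T")] -/
theorem centralizer_endAlg_le_endAlg_of_comm_isReduced_le_endAlg (S : Subalgebra ℚ (Module.End ℚ V)) [IsReduced S]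
    (hcomm : ∀ a ∈ S, ∀ b ∈ S, a * b = b * a) (hle : S ≤ H.endAlg) (hdim : Module.finrank ℚ S = Module.finrank ℚ V) :
    Subalgebra.centralizer ℚ (H.endAlg : Set (Module.End ℚ V)) ≤ H.endAlg :=
  (centralizer_endAlg_le_of_comm_isReduced_le_endAlg H S hcomm hle hdim).trans hle

/-- **Many endomorphisms ⟹ `C(H)` is commutative** (it sits inside the commutative `S`). [cite: Milne1999, Remark 1.10 (p. 53, "π(A) is commutative")] -/
theorem centralizer_endAlg_comm_of_comm_isReduced_le_endAlg (S : Subalgebra ℚ (Module.End ℚ V)) [IsReduced S]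
    (hcomm : ∀ a ∈ S, ∀ b ∈ S, a * b = b * a) (hle : S ≤ H.endAlg) (hdim : Module.finrank ℚ S = Module.finrank ℚ V) :
    ∀ c ∈ Subalgebra.centralizer ℚ (H.endAlg : Set (Module.End ℚ V)),
      ∀ c' ∈ Subalgebra.centralizer ℚ (H.endAlg : Set (Module.End ℚ V)), c * c' = c' * c := fun c hc c' hc' ↦
  hcomm c (centralizer_endAlg_le_of_comm_isReduced_le_endAlg H S hcomm hle hdim hc) c'
    (centralizer_endAlg_le_of_comm_isReduced_le_endAlg H S hcomm hle hdim hc')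

/-- **Many endomorphisms ⟹ `C₀(H) = C(H)`**: the canonical map from the centre of `E_φ` to the centraliser is onto.
[cite: Milne1999, Remark 1.10 (p. 53)] [cite: Milne1999LefschetzClasses, §1 Prop. 1.7 (p. 645, the same shape over a finite field)] -/
theorem map_val_center_endAlg_eq_centralizer_endAlg_of_comm_isReduced_le_endAlg (S : Subalgebra ℚ (Module.End ℚ V)) [IsReduced S]
    (hcomm : ∀ a ∈ S, ∀ b ∈ S, a * b = b * a) (hle : S ≤ H.endAlg) (hdim : Module.finrank ℚ S = Module.finrank ℚ V) :
    (Subalgebra.center ℚ H.endAlg).map H.endAlg.val = Subalgebra.centralizer ℚ (H.endAlg : Set (Module.End ℚ V)) :=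
  (map_val_center_endAlg_eq_centralizer_endAlg_iff H).2 (centralizer_endAlg_le_endAlg_of_comm_isReduced_le_endAlg H S hcomm hle hdim)

variable [HodgeTensorFacts.{u, u}]

/-- **`C₀(H) = C(H)` iff `H` is of CM type** in the tree's spelling `Lie Hg(H) ⊆ E_φ` (every pure `ℚ`-HS, no polarization:
`C(H) ⊆ E_φ` iff `Hg(H)(ℚ) ⊆ E_φ`, GGK's "`Z = T`", p02). [cite: GreenGriffithsKerr2012, §V.B (ii) and Ch. V (V.2) (proof)]
[cite: Milne1999, Remark 1.10 (p. 53)] -/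
theorem map_val_center_endAlg_eq_centralizer_endAlg_iff_hodgeLie_le :
    (Subalgebra.center ℚ H.endAlg).map H.endAlg.val = Subalgebra.centralizer ℚ (H.endAlg : Set (Module.End ℚ V)) ↔
      H.hodgeLie ≤ Subalgebra.toSubmodule H.endAlg := by
  rw [map_val_center_endAlg_eq_centralizer_endAlg_iff H, centralizer_endAlg_le_endAlg_iff_forall_hodgeGroup_mem_endAlg H,
    forall_hodgeGroup_mem_endAlg_iff_hodgeLie_le H]

/-- **For POLARIZABLE `H`: `C(H)` is commutative iff `H` is of CM type** (`Lie Hg(H) ⊆ E_φ`). "⟹": a commutative `C(H)` lies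
in its own centraliser `C(C(H)) = E_φ` (Remark 1.2), so `C(H) ⊆ E_φ`; "⟸": `C(H) ⊆ E_φ` and `C(H)` commutes with `E_φ`.
[cite: Milne1999, Remark 1.10 (p. 53, "π(A) is commutative (because its realizations are)")] [cite: Milne1999LefschetzClasses, §1 Remark 1.2 (p. 643)]
[cite: GreenGriffithsKerr2012, §V.B (i)–(ii)] -/
theorem centralizer_endAlg_comm_iff_hodgeLie_le (hH : H.IsPolarizable) :
    (∀ c ∈ Subalgebra.centralizer ℚ (H.endAlg : Set (Module.End ℚ V)),
        ∀ c' ∈ Subalgebra.centralizer ℚ (H.endAlg : Set (Module.End ℚ V)), c * c' = c' * c) ↔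
      H.hodgeLie ≤ Subalgebra.toSubmodule H.endAlg := by
  rw [← forall_hodgeGroup_mem_endAlg_iff_hodgeLie_le H, ← centralizer_endAlg_le_endAlg_iff_forall_hodgeGroup_mem_endAlg H]
  constructor
  · intro h c hc
    rw [← centralizer_centralizer_endAlg_eq H hH, Subalgebra.mem_centralizer_iff]
    intro c' hc'
    exact h c' hc' c hc
  · intro hCE c hc c' hc'
    exact ((Subalgebra.mem_centralizer_iff ℚ).1 hc c' (hCE hc')).symm

end ManyEndomorphisms

/-! ## §3 The Lefschetz groups of a CM Hodge structure are commutative — and conversely -/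

section LefschetzGroupCM

variable (K : Type uK) [Field K] [Algebra ℚ K] [Module.Finite ℚ V]

omit [Module.Finite ℚ V] in
/-- An element of the `K`-span of base changes `c_K`, `c ∈ S`, commutes with any `g` commuting with every `c_K`.
Private plumbing. [folklore] -/
private theorem mul_comm_of_mem_span_image_baseChange {S : Set (Module.End ℚ V)} {f : Module.End K (K ⊗[ℚ] V)}
    (hf : f ∈ Submodule.span K ((fun c : Module.End ℚ V ↦ c.baseChange K) '' S)) {g : Module.End K (K ⊗[ℚ] V)}
    (hg : ∀ s ∈ S, s.baseChange K * g = g * s.baseChange K) : f * g = g * f := by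
  induction hf using Submodule.span_induction with
  | mem f h =>
    obtain ⟨s, hs, rfl⟩ := h
    exact hg s hs
  | zero => rw [zero_mul, mul_zero]
  | add f f' _ _ hf hf' => rw [add_mul, mul_add, hf, hf']
  | smul c f _ hf => rw [smul_mul_assoc, mul_smul_comm, hf]

variable {K} in
/-- The mechanism of "`π(A)` is commutative": when `C(H) ⊆ E_φ`, two automorphisms of `K ⊗ V` commuting with `E_φ ⊗ K`
commute with each other (`δ ∈ C(H) ⊗ K`, and `γ` commutes with `C(H) ⊗ K ⊆ E_φ ⊗ K`). Private plumbing.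
[cite: Milne1999, Remark 1.10 (p. 53)] -/
private theorem mul_comm_of_forall_endAlg_baseChange_apply
    (hCE : Subalgebra.centralizer ℚ (H.endAlg : Set (Module.End ℚ V)) ≤ H.endAlg)
    {γ δ : (K ⊗[ℚ] V) ≃ₗ[K] (K ⊗[ℚ] V)}
    (hγ : ∀ a : H.endAlg, ∀ x, (a : Module.End ℚ V).baseChange K (γ x) = γ ((a : Module.End ℚ V).baseChange K x))
    (hδ : ∀ a : H.endAlg, ∀ x, (a : Module.End ℚ V).baseChange K (δ x) = δ ((a : Module.End ℚ V).baseChange K x)) :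
    γ * δ = δ * γ := by
  have hδC : (δ : Module.End K (K ⊗[ℚ] V)) ∈ Submodule.span K ((fun c : Module.End ℚ V ↦ c.baseChange K) ''
      (Subalgebra.centralizer ℚ (H.endAlg : Set (Module.End ℚ V)) : Set (Module.End ℚ V))) :=
    mem_span_baseChange_centralizer_of_forall_baseChange_comm K (H.endAlg : Set (Module.End ℚ V)) fun a ha ↦
      LinearMap.ext fun x ↦ (hδ ⟨a, ha⟩ x).symm
  have hcomm : (δ : Module.End K (K ⊗[ℚ] V)) * (γ : Module.End K (K ⊗[ℚ] V)) =
      (γ : Module.End K (K ⊗[ℚ] V)) * (δ : Module.End K (K ⊗[ℚ] V)) :=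
    mul_comm_of_mem_span_image_baseChange K hδC fun c hc ↦ LinearMap.ext fun x ↦ hγ ⟨c, hCE hc⟩ x
  refine LinearEquiv.ext fun x ↦ ?_
  have hx := LinearMap.congr_fun hcomm x
  rw [LinearEquiv.mul_apply, LinearEquiv.mul_apply]
  exact hx.symm

variable {H}

/-- **"`L(A) ≅ L₀(A)` … This shows that `π(A)` is commutative", and conversely, on `K`-points for every field `K ⊇ ℚ`: the
Lefschetz group `S(H)(K)` of a polarized `ℚ`-Hodge structure is commutative iff `H` is of CM type** (`Lie Hg(H) ⊆ E_φ`).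
"⟸": `S(H)(K) ⊆ C(H) ⊗ K` (g18-#1) with `C(H) ⊆ E_φ` commuting with `S(H)(K)`; "⟹": `Hg(H)(K) ⊆ S(H)(K)` (g18-#1) and
`Hg(H)(K)` commutative iff CM (p02, `K`-points). [cite: Milne1999, Remark 1.10 (p. 53)] [cite: GreenGriffithsKerr2012, Ch. V (V.1) and §V.B (i)–(ii)] -/
theorem Polarization.lefschetzGroupBaseChange_comm_iff_hodgeLie_le [HodgeTensorFacts.{u, u}] (Q : Polarization H) :
    (∀ γ ∈ Q.lefschetzGroupBaseChange K, ∀ δ ∈ Q.lefschetzGroupBaseChange K, γ * δ = δ * γ) ↔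
      H.hodgeLie ≤ Subalgebra.toSubmodule H.endAlg := by
  constructor
  · intro h
    exact (hodgeGroupBaseChange_comm_iff_hodgeLie_le_endAlg K H).1 fun γ hγ δ hδ ↦
      h γ (Q.hodgeGroupBaseChange_le_lefschetzGroupBaseChange K hγ) δ (Q.hodgeGroupBaseChange_le_lefschetzGroupBaseChange K hδ)
  · intro hCM γ hγ δ hδ
    have hCE : Subalgebra.centralizer ℚ (H.endAlg : Set (Module.End ℚ V)) ≤ H.endAlg :=
      (centralizer_endAlg_le_endAlg_iff_forall_hodgeGroup_mem_endAlg H).2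
        ((forall_hodgeGroup_mem_endAlg_iff_hodgeLie_le H).2 hCM)
    exact mul_comm_of_forall_endAlg_baseChange_apply H hCE hγ.1 hδ.1

/-- **The similitude group `G(H)(K)` (Milne's `L(A)(R) = {(γ, c) | γ†γ = c}` read in `GL(K ⊗ V)`) is commutative iff `H` is
of CM type**, every field `K ⊇ ℚ` ("⟹" through `MT(H)(K) ⊆ G(H)(K)` and Deligne's definition of CM on `K`-points, p02).
[cite: Milne1999, Remark 1.10 (p. 53)] [cite: Deligne1982HodgeCycles, I §5 (definition before Prop. 5.1)] -/
theorem Polarization.lefschetzSimilitudeGroupBaseChange_comm_iff_hodgeLie_le [HodgeTensorFacts.{u, u}] (Q : Polarization H) :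
    (∀ γ ∈ Q.lefschetzSimilitudeGroupBaseChange K, ∀ δ ∈ Q.lefschetzSimilitudeGroupBaseChange K, γ * δ = δ * γ) ↔
      H.hodgeLie ≤ Subalgebra.toSubmodule H.endAlg := by
  constructor
  · intro h
    exact (mumfordTateGroupBaseChange_comm_iff_hodgeLie_le_endAlg K H).1 fun γ hγ δ hδ ↦
      h γ (Q.mumfordTateGroupBaseChange_le_lefschetzSimilitudeGroupBaseChange K hγ) δ
        (Q.mumfordTateGroupBaseChange_le_lefschetzSimilitudeGroupBaseChange K hδ)
  · intro hCM γ hγ δ hδ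
    have hCE : Subalgebra.centralizer ℚ (H.endAlg : Set (Module.End ℚ V)) ≤ H.endAlg :=
      (centralizer_endAlg_le_endAlg_iff_forall_hodgeGroup_mem_endAlg H).2
        ((forall_hodgeGroup_mem_endAlg_iff_hodgeLie_le H).2 hCM)
    exact mul_comm_of_forall_endAlg_baseChange_apply H hCE hγ.1 hδ.1

/-- **On `ℚ`-points: `S(H)(ℚ)` is commutative iff `H` is of CM type.** "⟹": `Hg(H)(ℚ) ⊆ S(H)(ℚ)` and p02's
`hodgeGroup_comm_iff_hodgeLie_le_endAlg`; "⟸": `S(H)(ℚ) ⊆ C(H) ⊆ E_φ`. [cite: Milne1999, Remark 1.10 (p. 53)]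
[cite: GreenGriffithsKerr2012, Ch. V (V.1) and §V.B (i)–(ii)] -/
theorem Polarization.lefschetzGroup_comm_iff_hodgeLie_le [HodgeTensorFacts.{u, u}] (Q : Polarization H) :
    (∀ g ∈ Q.lefschetzGroup, ∀ g' ∈ Q.lefschetzGroup, g * g' = g' * g) ↔ H.hodgeLie ≤ Subalgebra.toSubmodule H.endAlg := by
  constructor
  · intro h
    exact (hodgeGroup_comm_iff_hodgeLie_le_endAlg H).1 fun g hg g' hg' ↦
      h g (Q.hodgeGroup_le_lefschetzGroup hg) g' (Q.hodgeGroup_le_lefschetzGroup hg')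
  · intro hCM g hg g' hg'
    have hCE : Subalgebra.centralizer ℚ (H.endAlg : Set (Module.End ℚ V)) ≤ H.endAlg :=
      (centralizer_endAlg_le_endAlg_iff_forall_hodgeGroup_mem_endAlg H).2
        ((forall_hodgeGroup_mem_endAlg_iff_hodgeLie_le H).2 hCM)
    have hgC := (forall_endAlg_apply_iff_coe_mem_centralizer_endAlg H g).1 hg.1
    have hg'C := (forall_endAlg_apply_iff_coe_mem_centralizer_endAlg H g').1 hg'.1
    have hc : (g' : Module.End ℚ V) * (g : Module.End ℚ V) = (g : Module.End ℚ V) * (g' : Module.End ℚ V) :=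
      (Subalgebra.mem_centralizer_iff ℚ).1 hgC _ (hCE hg'C)
    refine LinearEquiv.ext fun v ↦ ?_
    have hv := LinearMap.congr_fun hc v
    rw [LinearEquiv.mul_apply, LinearEquiv.mul_apply]
    exact hv.symm

/-- **`S(H)(ℚ) = S₀(H)(ℚ) = {γ ∈ C₀(H) | γ†γ = 1}` for a CM Hodge structure**: `g ∈ S(H)(ℚ)` iff `↑g` is (the image of) a
CENTRAL Hodge endomorphism with `g†g = 1` (g18-#1's `γ ∈ C(H), γ†γ = 1`, and `C(H) = C₀(H)`).
[cite: Milne1999LefschetzClasses, §1 p. 645 L6–L9 ("S₀(A)(R) = {γ ∈ C₀(A) ⊗ R | γ†γ = 1}")] [cite: Milne1999, Remark 1.10 (p. 53, "L(A) ≅ L₀(A)")] -/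
theorem Polarization.mem_lefschetzGroup_iff_exists_center_of_hodgeLie_le [HodgeTensorFacts.{u, u}] (Q : Polarization H)
    (hCM : H.hodgeLie ≤ Subalgebra.toSubmodule H.endAlg) (g : V ≃ₗ[ℚ] V) :
    g ∈ Q.lefschetzGroup ↔
      (∃ z ∈ Subalgebra.center ℚ H.endAlg, ((z : H.endAlg) : Module.End ℚ V) = g) ∧
        Q.adjoint (g : Module.End ℚ V) * (g : Module.End ℚ V) = 1 := by
  have hCE : Subalgebra.centralizer ℚ (H.endAlg : Set (Module.End ℚ V)) ≤ H.endAlg :=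
    (centralizer_endAlg_le_endAlg_iff_forall_hodgeGroup_mem_endAlg H).2 ((forall_hodgeGroup_mem_endAlg_iff_hodgeLie_le H).2 hCM)
  rw [Q.mem_lefschetzGroup_iff_adjoint_mul_self_eq_one]
  refine and_congr_left fun _ ↦ ⟨fun hgC ↦ ?_, ?_⟩
  · exact ⟨⟨(g : Module.End ℚ V), hCE hgC⟩, (mem_center_endAlg_iff_coe_mem_centralizer_endAlg H _).2 hgC, rfl⟩
  · rintro ⟨z, hz, hzg⟩
    rw [← hzg]
    exact (mem_center_endAlg_iff_coe_mem_centralizer_endAlg H z).1 hz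

variable {K} in
/-- **`S(H)(K) ⊆ C₀(H) ⊗ K` for a CM Hodge structure** ("`L(A) ≅ L₀(A)_{/Q}`" on `K`-points): an element of `S(H)(K)` is a
`K`-linear combination of base changes `z_K` of CENTRAL Hodge endomorphisms `z ∈ Z(E_φ)`.
[cite: Milne1999, Remark 1.10 (p. 53)] [cite: Milne1999LefschetzClasses, §1 p. 645 and Remark 1.6] -/
theorem Polarization.coe_mem_span_baseChange_center_of_mem_lefschetzGroupBaseChange [HodgeTensorFacts.{u, u}]
    (Q : Polarization H) (hCM : H.hodgeLie ≤ Subalgebra.toSubmodule H.endAlg) {γ : (K ⊗[ℚ] V) ≃ₗ[K] (K ⊗[ℚ] V)}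
    (hγ : γ ∈ Q.lefschetzGroupBaseChange K) :
    (γ : Module.End K (K ⊗[ℚ] V)) ∈ Submodule.span K
      (Set.range fun z : Subalgebra.center ℚ H.endAlg ↦ ((z : H.endAlg) : Module.End ℚ V).baseChange K) := by
  have hCE : Subalgebra.centralizer ℚ (H.endAlg : Set (Module.End ℚ V)) ≤ H.endAlg :=
    (centralizer_endAlg_le_endAlg_iff_forall_hodgeGroup_mem_endAlg H).2 ((forall_hodgeGroup_mem_endAlg_iff_hodgeLie_le H).2 hCM)
  refine Submodule.span_mono ?_ (Q.coe_mem_span_baseChange_centralizer_endAlg_of_mem_lefschetzGroupBaseChange hγ)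
  rintro _ ⟨c, hc, rfl⟩
  exact ⟨⟨⟨c, hCE hc⟩, (mem_center_endAlg_iff_coe_mem_centralizer_endAlg H _).2 hc⟩, rfl⟩

end LefschetzGroupCM

end HodgeStructure

end Literature.AlgebraicGeometry.Motives
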